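import Mathlib
import Summits.Ventures.PercRepro2.Defs
import Summits.Ventures.PercRepro2.CoinKStarLattice
import Summits.Ventures.PercRepro2.CoinKStarTilt
import Summits.Ventures.PercRepro2.CoinKStarLaw
import Summits.Ventures.PercRepro2.CoinLsmHeadLaw

/-!
# The weights of the LSM-head proof and their dominations (blind cell PercRepro2, night-2 g5;
proofs/NIGHT2-DARC.md §26.2–§26.3)

The three FKG weight families of `S′ = M₁ + C₁ − C₂` on the leaf lattice — `wA = hA · F(·)`
(the traces `L`, `w ∉ K⁻`), `wA' = hA · F(· ∪ {w, u})` (the gate cells), `wΩ = β · F(· ∪ {w, u})`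
— and the w-part `wB = hB · F(· ∪ {w})`; their log-supermodularity and the Holley dominations
(F1) `wA ≼ wB`, (F2) `wA ≼ wA'`, (F3) `wA' ≼ wΩ`, (LA) `wA + wB ≼ wΩ`, from the
log-supermodularity of `F` and of `β` and the set identities of the extra vertices `w, u ∉ Vs`.
-/

namespace Summit.Ventures.PercRepro2.Coin

section LsmHeadSteps

open Classical

variable {V : Type*} [DecidableEq V] {R : Type*} [Field R] [LinearOrder R]
  [IsStrictOrderedRing R]

/-- The weight of the trace `L` (`w ∉ K⁻`). -/
def wA (β : Finset V → R) (q : V → R) (F : Finset V → R) (L : Finset V) : R :=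
  hA β q L * F L

/-- The weight of the gate cell at the trace `L ∪ {w}`, with the `w ∉ K⁻` factor. -/
def wA' (β : Finset V → R) (q : V → R) (F : Finset V → R) (w u : V) (L : Finset V) : R :=
  hA β q L * F (insert u (insert w L))

/-- The weight of the gate cell at the trace `L ∪ {w}` without the arm factor. -/
def wΩ (β : Finset V → R) (F : Finset V → R) (w u : V) (L : Finset V) : R :=
  β L * F (insert u (insert w L))

/-- The weight of the trace `L ∪ {w}`. -/
def wB (β : Finset V → R) (q : V → R) (F : Finset V → R) (w : V) (L : Finset V) : R :=
  hB β q L * F (insert w L)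

section SetIdentities

variable {w u : V} {Vs : Finset V}

omit [Field R] [LinearOrder R] [IsStrictOrderedRing R] in
/-- `L ∩ insert w L' = L ∩ L'` and `L ∪ insert w L' = insert w (L ∪ L')` for `w ∉ L`. -/
lemma lsm_set₁ (hw : w ∉ Vs) {L L' : Finset V} (hL : L ⊆ Vs) :
    L ∩ insert w L' = L ∩ L' ∧ L ∪ insert w L' = insert w (L ∪ L') :=
  ⟨by rw [Finset.inter_comm, insert_inter_of_notMem' (fun h => hw (hL h)), Finset.inter_comm],
    by rw [Finset.union_comm, insert_union', Finset.union_comm]⟩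

omit [Field R] [LinearOrder R] [IsStrictOrderedRing R] in
/-- The same with `insert u (insert w L')`. -/
lemma lsm_set₂ (hw : w ∉ Vs) (hu : u ∉ Vs) {L L' : Finset V} (hL : L ⊆ Vs) :
    L ∩ insert u (insert w L') = L ∩ L' ∧
      L ∪ insert u (insert w L') = insert u (insert w (L ∪ L')) :=
  ⟨by rw [Finset.inter_comm, insert_inter_of_notMem' (fun h => hu (hL h)), Finset.inter_comm,
      (lsm_set₁ hw hL).1],
    by rw [Finset.union_comm, insert_union', Finset.union_comm, (lsm_set₁ hw hL).2]⟩

omit [Field R] [LinearOrder R] [IsStrictOrderedRing R] in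
/-- Two gate cells. -/
lemma lsm_set₃ (L L' : Finset V) :
    insert u (insert w L) ∩ insert u (insert w L') = insert u (insert w (L ∩ L')) ∧
      insert u (insert w L) ∪ insert u (insert w L') = insert u (insert w (L ∪ L')) :=
  ⟨by rw [insert_inter_insert'', insert_inter_insert''],
    by rw [insert_union_insert'', insert_union_insert'']⟩

omit [Field R] [LinearOrder R] [IsStrictOrderedRing R] in
/-- A `w`-trace against a gate cell. -/
lemma lsm_set₄ (hwu : w ≠ u) (hu : u ∉ Vs) {L L' : Finset V} (hL : L ⊆ Vs) :
    insert w L ∩ insert u (insert w L') = insert w (L ∩ L') ∧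
      insert w L ∪ insert u (insert w L') = insert u (insert w (L ∪ L')) := by
  have hunotinw : u ∉ insert w L := fun h => by
    rcases Finset.mem_insert.mp h with h | h
    · exact hwu h.symm
    · exact hu (hL h)
  exact ⟨by rw [Finset.inter_comm, insert_inter_of_notMem' hunotinw, Finset.inter_comm,
      insert_inter_insert''],
    by rw [Finset.union_comm, insert_union', Finset.union_comm, insert_union_insert'']⟩

end SetIdentities

section Weights

variable {Vs : Finset V} {w u : V} {β : Finset V → R} {q : V → R} {F : Finset V → R}

omit [DecidableEq V] in
/-- `wA ≥ 0`. -/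
lemma wA_nonneg
    (hF0 : ∀ S, 0 ≤ F S) (hβ0 : ∀ L ⊆ Vs, 0 ≤ β L) (hq0 : ∀ i ∈ Vs, 0 ≤ q i) {L : Finset V} (hL : L ⊆ Vs) : 0 ≤ wA β q F L :=
  mul_nonneg (hA_nonneg hβ0 hq0 hL) (hF0 _)

/-- `wA' ≥ 0`. -/
lemma wA'_nonneg
    (hF0 : ∀ S, 0 ≤ F S) (hβ0 : ∀ L ⊆ Vs, 0 ≤ β L) (hq0 : ∀ i ∈ Vs, 0 ≤ q i) {L : Finset V} (hL : L ⊆ Vs) : 0 ≤ wA' β q F w u L :=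
  mul_nonneg (hA_nonneg hβ0 hq0 hL) (hF0 _)

/-- `wΩ ≥ 0`. -/
lemma wΩ_nonneg
    (hF0 : ∀ S, 0 ≤ F S) (hβ0 : ∀ L ⊆ Vs, 0 ≤ β L) {L : Finset V} (hL : L ⊆ Vs) : 0 ≤ wΩ β F w u L :=
  mul_nonneg (hβ0 L hL) (hF0 _)

/-- `wB ≥ 0`. -/
lemma wB_nonneg
    (hF0 : ∀ S, 0 ≤ F S) (hβ0 : ∀ L ⊆ Vs, 0 ≤ β L) (hq0 : ∀ i ∈ Vs, 0 ≤ q i) (hq1 : ∀ i ∈ Vs, q i ≤ 1) {L : Finset V} (hL : L ⊆ Vs) : 0 ≤ wB β q F w L :=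
  mul_nonneg (hB_nonneg hβ0 hq0 hq1 hL) (hF0 _)

/-- `wA` is log-supermodular. -/
lemma wA_lsm
    (hF0 : ∀ S, 0 ≤ F S) (hFlsm : ∀ S S', F S * F S' ≤ F (S ∩ S') * F (S ∪ S')) (hβ0 : ∀ L ⊆ Vs, 0 ≤ β L) (hβ : ∀ L L', L ⊆ Vs → L' ⊆ Vs → β L * β L' ≤ β (L ∩ L') * β (L ∪ L')) (hq0 : ∀ i ∈ Vs, 0 ≤ q i) {L L' : Finset V} (hL : L ⊆ Vs) (hL' : L' ⊆ Vs) :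
    wA β q F L * wA β q F L' ≤ wA β q F (L ∩ L') * wA β q F (L ∪ L') := by
  simp only [wA]
  calc hA β q L * F L * (hA β q L' * F L')
      = (hA β q L * hA β q L') * (F L * F L') := by ring
    _ ≤ (hA β q (L ∩ L') * hA β q (L ∪ L')) * (F (L ∩ L') * F (L ∪ L')) :=
        mul_le_mul (hA_mul_le hβ hq0 hL hL') (hFlsm L L') (mul_nonneg (hF0 _) (hF0 _))
          (mul_nonneg (hA_nonneg hβ0 hq0 (Finset.inter_subset_left.trans hL))
            (hA_nonneg hβ0 hq0 (Finset.union_subset hL hL')))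
    _ = _ := by ring

/-- `wA'` is log-supermodular. -/
lemma wA'_lsm
    (hF0 : ∀ S, 0 ≤ F S) (hFlsm : ∀ S S', F S * F S' ≤ F (S ∩ S') * F (S ∪ S')) (hβ0 : ∀ L ⊆ Vs, 0 ≤ β L) (hβ : ∀ L L', L ⊆ Vs → L' ⊆ Vs → β L * β L' ≤ β (L ∩ L') * β (L ∪ L')) (hq0 : ∀ i ∈ Vs, 0 ≤ q i) {L L' : Finset V} (hL : L ⊆ Vs) (hL' : L' ⊆ Vs) :
    wA' β q F w u L * wA' β q F w u L' ≤ wA' β q F w u (L ∩ L') * wA' β q F w u (L ∪ L') := by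
  simp only [wA']
  have h := hFlsm (insert u (insert w L)) (insert u (insert w L'))
  rw [(lsm_set₃ (w := w) (u := u) L L').1, (lsm_set₃ (w := w) (u := u) L L').2] at h
  calc hA β q L * F (insert u (insert w L)) * (hA β q L' * F (insert u (insert w L')))
      = (hA β q L * hA β q L') * (F (insert u (insert w L)) * F (insert u (insert w L'))) := by
        ring
    _ ≤ (hA β q (L ∩ L') * hA β q (L ∪ L')) *
          (F (insert u (insert w (L ∩ L'))) * F (insert u (insert w (L ∪ L')))) :=
        mul_le_mul (hA_mul_le hβ hq0 hL hL') h (mul_nonneg (hF0 _) (hF0 _))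
          (mul_nonneg (hA_nonneg hβ0 hq0 (Finset.inter_subset_left.trans hL))
            (hA_nonneg hβ0 hq0 (Finset.union_subset hL hL')))
    _ = _ := by ring

/-- `wΩ` is log-supermodular. -/
lemma wΩ_lsm
    (hF0 : ∀ S, 0 ≤ F S) (hFlsm : ∀ S S', F S * F S' ≤ F (S ∩ S') * F (S ∪ S')) (hβ0 : ∀ L ⊆ Vs, 0 ≤ β L) (hβ : ∀ L L', L ⊆ Vs → L' ⊆ Vs → β L * β L' ≤ β (L ∩ L') * β (L ∪ L')) {L L' : Finset V} (hL : L ⊆ Vs) (hL' : L' ⊆ Vs) :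
    wΩ β F w u L * wΩ β F w u L' ≤ wΩ β F w u (L ∩ L') * wΩ β F w u (L ∪ L') := by
  simp only [wΩ]
  have h := hFlsm (insert u (insert w L)) (insert u (insert w L'))
  rw [(lsm_set₃ (w := w) (u := u) L L').1, (lsm_set₃ (w := w) (u := u) L L').2] at h
  calc β L * F (insert u (insert w L)) * (β L' * F (insert u (insert w L')))
      = (β L * β L') * (F (insert u (insert w L)) * F (insert u (insert w L'))) := by ring
    _ ≤ (β (L ∩ L') * β (L ∪ L')) *
          (F (insert u (insert w (L ∩ L'))) * F (insert u (insert w (L ∪ L')))) :=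
        mul_le_mul (hβ L L' hL hL') h (mul_nonneg (hF0 _) (hF0 _))
          (mul_nonneg (hβ0 _ (Finset.inter_subset_left.trans hL))
            (hβ0 _ (Finset.union_subset hL hL')))
    _ = _ := by ring

/-- (F1) `wB` dominates `wA`: `wA L · wB L' ≤ wA (L ∩ L') · wB (L ∪ L')`. -/
lemma dom_wA_wB
    (hw : w ∉ Vs) (hF0 : ∀ S, 0 ≤ F S) (hFlsm : ∀ S S', F S * F S' ≤ F (S ∩ S') * F (S ∪ S')) (hβ0 : ∀ L ⊆ Vs, 0 ≤ β L) (hβ : ∀ L L', L ⊆ Vs → L' ⊆ Vs → β L * β L' ≤ β (L ∩ L') * β (L ∪ L')) (hq0 : ∀ i ∈ Vs, 0 ≤ q i) (hq1 : ∀ i ∈ Vs, q i ≤ 1) {L L' : Finset V} (hL : L ⊆ Vs) (hL' : L' ⊆ Vs) :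
    wA β q F L * wB β q F w L' ≤ wA β q F (L ∩ L') * wB β q F w (L ∪ L') := by
  simp only [wA, wB]
  have h := hFlsm L (insert w L')
  rw [(lsm_set₁ hw hL).1, (lsm_set₁ hw hL).2] at h
  calc hA β q L * F L * (hB β q L' * F (insert w L'))
      = (hA β q L * hB β q L') * (F L * F (insert w L')) := by ring
    _ ≤ (hA β q (L ∩ L') * hB β q (L ∪ L')) * (F (L ∩ L') * F (insert w (L ∪ L'))) :=
        mul_le_mul (hA_mul_hB_le hβ0 hβ hq0 hq1 hL hL') h (mul_nonneg (hF0 _) (hF0 _))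
          (mul_nonneg (hA_nonneg hβ0 hq0 (Finset.inter_subset_left.trans hL))
            (hB_nonneg hβ0 hq0 hq1 (Finset.union_subset hL hL')))
    _ = _ := by ring

/-- (F2) `wA'` dominates `wA`. -/
lemma dom_wA_wA'
    (hw : w ∉ Vs) (hu : u ∉ Vs) (hF0 : ∀ S, 0 ≤ F S) (hFlsm : ∀ S S', F S * F S' ≤ F (S ∩ S') * F (S ∪ S')) (hβ0 : ∀ L ⊆ Vs, 0 ≤ β L) (hβ : ∀ L L', L ⊆ Vs → L' ⊆ Vs → β L * β L' ≤ β (L ∩ L') * β (L ∪ L')) (hq0 : ∀ i ∈ Vs, 0 ≤ q i) {L L' : Finset V} (hL : L ⊆ Vs) (hL' : L' ⊆ Vs) :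
    wA β q F L * wA' β q F w u L' ≤ wA β q F (L ∩ L') * wA' β q F w u (L ∪ L') := by
  simp only [wA, wA']
  have h := hFlsm L (insert u (insert w L'))
  rw [(lsm_set₂ hw hu hL).1, (lsm_set₂ hw hu hL).2] at h
  calc hA β q L * F L * (hA β q L' * F (insert u (insert w L')))
      = (hA β q L * hA β q L') * (F L * F (insert u (insert w L'))) := by ring
    _ ≤ (hA β q (L ∩ L') * hA β q (L ∪ L')) *
          (F (L ∩ L') * F (insert u (insert w (L ∪ L')))) :=
        mul_le_mul (hA_mul_le hβ hq0 hL hL') h (mul_nonneg (hF0 _) (hF0 _))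
          (mul_nonneg (hA_nonneg hβ0 hq0 (Finset.inter_subset_left.trans hL))
            (hA_nonneg hβ0 hq0 (Finset.union_subset hL hL')))
    _ = _ := by ring

/-- (F3) `wΩ` dominates `wA'`. -/
lemma dom_wA'_wΩ
    (hF0 : ∀ S, 0 ≤ F S) (hFlsm : ∀ S S', F S * F S' ≤ F (S ∩ S') * F (S ∪ S')) (hβ0 : ∀ L ⊆ Vs, 0 ≤ β L) (hβ : ∀ L L', L ⊆ Vs → L' ⊆ Vs → β L * β L' ≤ β (L ∩ L') * β (L ∪ L')) (hq0 : ∀ i ∈ Vs, 0 ≤ q i) (hq1 : ∀ i ∈ Vs, q i ≤ 1) {L L' : Finset V} (hL : L ⊆ Vs) (hL' : L' ⊆ Vs) :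
    wA' β q F w u L * wΩ β F w u L' ≤ wA' β q F w u (L ∩ L') * wΩ β F w u (L ∪ L') := by
  simp only [wA', wΩ]
  have h := hFlsm (insert u (insert w L)) (insert u (insert w L'))
  rw [(lsm_set₃ (w := w) (u := u) L L').1, (lsm_set₃ (w := w) (u := u) L L').2] at h
  calc hA β q L * F (insert u (insert w L)) * (β L' * F (insert u (insert w L')))
      = (hA β q L * β L') * (F (insert u (insert w L)) * F (insert u (insert w L'))) := by ring
    _ ≤ (hA β q (L ∩ L') * β (L ∪ L')) *
          (F (insert u (insert w (L ∩ L'))) * F (insert u (insert w (L ∪ L')))) :=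
        mul_le_mul (hA_mul_β_le hβ0 hβ hq0 hq1 hL hL') h (mul_nonneg (hF0 _) (hF0 _))
          (mul_nonneg (hA_nonneg hβ0 hq0 (Finset.inter_subset_left.trans hL))
            (hβ0 _ (Finset.union_subset hL hL')))
    _ = _ := by ring

/-- (LA) `wΩ` dominates the mixture `wA + wB` (`F` decreasing, `π` decreasing). -/
lemma dom_mix_wΩ (hw : w ∉ Vs) (hu : u ∉ Vs) (hwu : w ≠ u) (hF0 : ∀ S, 0 ≤ F S)
    (hFdec : ∀ S S', S ⊆ S' → F S' ≤ F S)
    (hFlsm : ∀ S S', F S * F S' ≤ F (S ∩ S') * F (S ∪ S')) (hβ0 : ∀ L ⊆ Vs, 0 ≤ β L)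
    (hβ : ∀ L L', L ⊆ Vs → L' ⊆ Vs → β L * β L' ≤ β (L ∩ L') * β (L ∪ L'))
    (hq0 : ∀ i ∈ Vs, 0 ≤ q i) (hq1 : ∀ i ∈ Vs, q i ≤ 1) {L L' : Finset V}
    (hL : L ⊆ Vs) (hL' : L' ⊆ Vs) :
    (wA β q F L + wB β q F w L) * wΩ β F w u L' ≤
      (wA β q F (L ∩ L') + wB β q F w (L ∩ L')) * wΩ β F w u (L ∪ L') := by
  simp only [wA, wB, wΩ, hA, hB]
  have hanti : armProd q L ≤ armProd q (L ∩ L') :=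
    armProd_anti hq0 hq1 Finset.inter_subset_left hL
  have hdec : F (insert w (L ∩ L')) ≤ F (L ∩ L') := hFdec _ _ (Finset.subset_insert _ _)
  have hl0 : 0 ≤ β (L ∩ L') * β (L ∪ L') :=
    mul_nonneg (hβ0 _ (Finset.inter_subset_left.trans hL)) (hβ0 _ (Finset.union_subset hL hL'))
  have hπ0 : 0 ≤ armProd q L := armProd_nonneg hq0 hL
  have hπ1 : armProd q L ≤ 1 := armProd_le_one hq0 hq1 hL
  have h3 := hFlsm L (insert u (insert w L'))
  rw [(lsm_set₂ hw hu hL).1, (lsm_set₂ hw hu hL).2] at h3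
  have h5 := hFlsm (insert w L) (insert u (insert w L'))
  rw [(lsm_set₄ hwu hu hL).1, (lsm_set₄ hwu hu hL).2] at h5
  have e1 : (β L * armProd q L * F L + β L * (1 - armProd q L) * F (insert w L)) *
        (β L' * F (insert u (insert w L'))) =
      (β L * β L') * (armProd q L * (F L * F (insert u (insert w L'))) +
        (1 - armProd q L) * (F (insert w L) * F (insert u (insert w L')))) := by ring
  have e2 : (β (L ∩ L') * armProd q (L ∩ L') * F (L ∩ L') +
        β (L ∩ L') * (1 - armProd q (L ∩ L')) * F (insert w (L ∩ L'))) *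
        (β (L ∪ L') * F (insert u (insert w (L ∪ L')))) =
      (β (L ∩ L') * β (L ∪ L')) *
        (armProd q (L ∩ L') * (F (L ∩ L') * F (insert u (insert w (L ∪ L')))) +
          (1 - armProd q (L ∩ L')) *
            (F (insert w (L ∩ L')) * F (insert u (insert w (L ∪ L'))))) := by ring
  rw [e1, e2]
  refine mul_le_mul (hβ L L' hL hL') ?_ ?_ hl0
  swap
  · exact add_nonneg (mul_nonneg hπ0 (mul_nonneg (hF0 _) (hF0 _)))
      (mul_nonneg (sub_nonneg.mpr hπ1) (mul_nonneg (hF0 _) (hF0 _)))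
  have hB' : F (insert w (L ∩ L')) * F (insert u (insert w (L ∪ L'))) ≤
      F (L ∩ L') * F (insert u (insert w (L ∪ L'))) := mul_le_mul_of_nonneg_right hdec (hF0 _)
  have k1 := mul_le_mul_of_nonneg_left h3 hπ0
  have k2 := mul_le_mul_of_nonneg_left h5 (sub_nonneg.mpr hπ1)
  have k3 := mul_le_mul_of_nonneg_left hB' (sub_nonneg.mpr hanti)
  linarith

end Weights

end LsmHeadSteps

end Summit.Ventures.PercRepro2.Coin
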